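import Summits.Ventures.YMGap.Census.MarkedPlaquetteTransport
import HarnessLib

/-!
# Venture YMGap, track (b) — the unit-cube patterns of the even torus: parity classes of cube bases, their invariance
# under the Osterwalder–Seiler reflection, and their transport to the reflection hyperplane

HONEST FRAMING: venture file of the cell `pub-ymgap` (QuantumFields programme), track (b); pure lattice combinatorics of
the even torus `(ℤ/Lℤ)^d` (no integral, no claim about Tomboulis's (5.15), limits, confinement or a mass gap).  It is the
geometric input of the cell's kernel version of Tomboulis's Prop. II.1 (ii) (arXiv:0707.2179 eq. (2.13), App. A §1) with a
proof-faithful exponent: comparing `Z_Λ({c_j})` with the partition function of a field supported on a family of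
link-disjoint unit 3-cubes needs, for the reflection-positivity step at EVERY plaquette, that the family — after the
lattice symmetry carrying that plaquette onto the reflection hyperplane — is still symmetric under the reflection.

## Contents (namespace `Summit.Ventures.YMGap.Census`)

* `sitePar x = (x_m mod 2)_m` — parity vectors (a homomorphism for even `L`: `sitePar_add`, `sitePar_shift`,
  `sitePar_timeReflect`, `sitePar_shift_timeReflect`).
* `IsCubeFace D P p` / `cubePattern D P` — `p` is a face of a unit 3-cube spanned by the three directions `D` whose base point
  has parity vector in the class set `P` (`P` a set of parity vectors closed under changing coordinates outside `D`,
  `IsOutsideClosed`): the two directions of `p` lie in `D` and, `k` being the third, the base of `p` or the base minus `e_k` has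
  parity in `P`.
* `isCubeFace_plaqReflect_iff` — every such pattern is invariant under `WilsonRP.plaqReflect` (`L` even, `D.card = 3`).
* `isCubeFace_plaqShift_iff`, `isCubeFace_plaqTranspose_iff` — translations and transpositions map patterns to patterns
  (`parShift`, `parTranspose`, `dirsImage`).
* `exists_isCrossPlaq_transport` — every plaquette is carried onto a crossing plaquette by a transposition `0 ↔ μ` and a
  translation (the transport of `MarkedPlaquetteTransport.markedIntegral_nonneg`, isolated);
  **`cubePattern_transport`** — and the transported pattern is reflection invariant.

Reference for the role of this bookkeeping: E. T. Tomboulis, arXiv:0707.2179, App. A §1 [cite: Tomboulis2007Confinement,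
App. A §1]; K. Osterwalder, E. Seiler, Ann. Phys. 110 (1978) 440, §2 [cite: OsterwalderSeilerAnnPhys1978, §2].
-/

noncomputable section

open Finset
open Literature.MathematicalPhysics.QuantumLattice
open Literature.MathematicalPhysics.QuantumFieldTheory
open Literature.MathematicalPhysics.QuantumFieldTheory.Tomboulis2007
open Literature.MathematicalPhysics.QuantumFieldTheory.WilsonRP

namespace Summit.Ventures.YMGap.Census

variable {d L : ℕ}

/-! ### Parity vectors of sites -/

/-- The parity vector of a site of `(ℤ/Lℤ)^d`: `m ↦ x_m mod 2` (meaningful for even `L`). -/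
def sitePar (x : Site d L) : Fin d → ZMod 2 := fun m => ZMod.cast (x m)

/-- In `(ℤ/2ℤ)^d` every vector is its own negative: `u + u = 0`. -/
theorem par_add_self (u : Fin d → ZMod 2) : u + u = 0 := by
  funext m
  simp only [Pi.add_apply, Pi.zero_apply]
  calc u m + u m = u m + -u m := by rw [ZMod.neg_eq_self_mod_two]
    _ = 0 := add_neg_cancel _

/-- `(w + u) + u = w` in `(ℤ/2ℤ)^d`. -/
theorem par_add_add_cancel (w u : Fin d → ZMod 2) : w + u + u = w := by
  rw [add_assoc, par_add_self, add_zero]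

/-- For even `L` the parity vector is additive. -/
theorem sitePar_add (hL : Even L) (x y : Site d L) : sitePar (x + y) = sitePar x + sitePar y := by
  funext m
  simp only [sitePar, Pi.add_apply]
  exact ZMod.cast_add (even_iff_two_dvd.mp hL) _ _

/-- The parity vector of the unit vector `e_k` is the unit vector. -/
theorem sitePar_single (hL : Even L) (k : Fin d) :
    sitePar (Pi.single k (1 : ZMod L) : Site d L) = Pi.single k 1 := by
  funext m
  by_cases hm : m = k
  · subst hm
    simp only [sitePar, Pi.single_eq_same]
    exact ZMod.cast_one (even_iff_two_dvd.mp hL)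
  · simp only [sitePar, Pi.single_apply, hm, ↓reduceIte, ZMod.cast_zero]

/-- `sitePar (x + e_k) = sitePar x + e_k`. -/
theorem sitePar_shift (hL : Even L) (x : Site d L) (k : Fin d) :
    sitePar (x.shift k) = sitePar x + Pi.single k 1 := by
  rw [Site.shift, sitePar_add hL, sitePar_single hL]

/-- The Osterwalder–Seiler reflection of a spatial base point flips the time parity: `sitePar θx = sitePar x + e₀`. -/
theorem sitePar_timeReflect [NeZero d] (hL : Even L) (x : Site d L) :
    sitePar x.timeReflect = sitePar x + Pi.single 0 1 := by
  funext m
  by_cases hm : m = 0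
  · subst hm
    simp only [sitePar, timeReflect_apply_zero, Pi.add_apply, Pi.single_eq_same]
    rw [ZMod.cast_sub (even_iff_two_dvd.mp hL), ZMod.cast_one (even_iff_two_dvd.mp hL), sub_eq_add_neg,
      ZMod.neg_eq_self_mod_two, add_comm]
  · simp only [sitePar, timeReflect_apply_of_ne _ hm, Pi.add_apply, Pi.single_apply, hm, ↓reduceIte, add_zero]

/-- The reflection of a temporal base point preserves the parity: `sitePar θ(x + e₀) = sitePar x`. -/
theorem sitePar_shift_timeReflect [NeZero d] (hL : Even L) (x : Site d L) :
    sitePar (x.shift 0).timeReflect = sitePar x := by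
  rw [sitePar_timeReflect hL, sitePar_shift hL, par_add_add_cancel]

/-- Transposed sites: `sitePar (x ∘ (μ ν)) = sitePar x ∘ (μ ν)`. -/
theorem sitePar_siteTranspose (μ ν : Fin d) (x : Site d L) :
    sitePar (siteTranspose μ ν x) = sitePar x ∘ Equiv.swap μ ν := by
  funext m
  rfl

/-- Unit parity vectors under a transposition: `e_k ∘ (μ ν) = e_{(μ ν) k}`. -/
theorem single_comp_swap (μ ν k : Fin d) :
    (Pi.single k (1 : ZMod 2) : Fin d → ZMod 2) ∘ Equiv.swap μ ν = Pi.single (Equiv.swap μ ν k) 1 := by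
  funext m
  simp only [Function.comp_apply, Pi.single_apply, Equiv.swap_apply_eq_iff]

/-! ### Cube patterns -/

/-- **`p` is a face of a pattern cube**: the two directions of `p` lie in the direction set `D` and, `k ∈ D` being a third
direction, the unit cube spanned by `D` with base `x` (lower `k`-face `p`) or with base `x - e_k` (upper `k`-face `p`) has its
base parity vector in the class set `P` (a decidable predicate on plaquettes, not a statement). [folklore] -/
def IsCubeFace (D : Finset (Fin d)) (P : Finset (Fin d → ZMod 2)) (p : Plaquette d L) : Prop :=
  p.2.1.1 ∈ D ∧ p.2.1.2 ∈ D ∧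
    ∃ k ∈ D, k ≠ p.2.1.1 ∧ k ≠ p.2.1.2 ∧ (sitePar p.1 ∈ P ∨ sitePar p.1 + Pi.single k 1 ∈ P)

/-- `IsCubeFace D P` is decidable. -/
instance (D : Finset (Fin d)) (P : Finset (Fin d → ZMod 2)) : DecidablePred (IsCubeFace (L := L) D P) := fun _ => by
  unfold IsCubeFace; infer_instance

/-- The set of pattern plaquettes. -/
def cubePattern [NeZero L] (D : Finset (Fin d)) (P : Finset (Fin d → ZMod 2)) : Finset (Plaquette d L) :=
  univ.filter (IsCubeFace D P)

/-- Membership in `cubePattern`. -/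
theorem mem_cubePattern [NeZero L] {D : Finset (Fin d)} {P : Finset (Fin d → ZMod 2)} {p : Plaquette d L} :
    p ∈ cubePattern D P ↔ IsCubeFace D P p := by
  simp [cubePattern]

/-- The class set ignores the coordinates outside `D` (a hypothesis predicate on the data `(D, P)`, not a statement).
[folklore] -/
def IsOutsideClosed (D : Finset (Fin d)) (P : Finset (Fin d → ZMod 2)) : Prop :=
  ∀ w ∈ P, ∀ m ∉ D, w + Pi.single m 1 ∈ P

/-- Changing a coordinate outside `D` does not change membership in a closed class set. -/
theorem IsOutsideClosed.mem_add_iff {D : Finset (Fin d)} {P : Finset (Fin d → ZMod 2)} (hP : IsOutsideClosed D P) {m : Fin d}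
    (hm : m ∉ D) (w : Fin d → ZMod 2) : w + Pi.single m 1 ∈ P ↔ w ∈ P :=
  ⟨fun h => by simpa only [par_add_add_cancel] using hP _ h m hm, fun h => hP w h m hm⟩

/-- The pattern condition as a predicate of the parity vector of the base point and the two directions (symmetric in the
directions; plumbing for the transposition lemma). [folklore] -/
def IsCubeFaceAt (D : Finset (Fin d)) (P : Finset (Fin d → ZMod 2)) (w : Fin d → ZMod 2) (i j : Fin d) : Prop :=
  i ∈ D ∧ j ∈ D ∧ ∃ k ∈ D, k ≠ i ∧ k ≠ j ∧ (w ∈ P ∨ w + Pi.single k 1 ∈ P)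

/-- `IsCubeFace` in terms of `IsCubeFaceAt`. -/
theorem isCubeFace_iff_patCond (D : Finset (Fin d)) (P : Finset (Fin d → ZMod 2)) (p : Plaquette d L) :
    IsCubeFace D P p ↔ IsCubeFaceAt D P (sitePar p.1) p.2.1.1 p.2.1.2 := Iff.rfl

/-- `IsCubeFaceAt` is symmetric in the two directions. -/
theorem isCubeFaceAt_comm (D : Finset (Fin d)) (P : Finset (Fin d → ZMod 2)) (w : Fin d → ZMod 2) (i j : Fin d) :
    IsCubeFaceAt D P w i j ↔ IsCubeFaceAt D P w j i := by
  unfold IsCubeFaceAt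
  constructor
  · rintro ⟨hi, hj, k, hk, hki, hkj, h⟩
    exact ⟨hj, hi, k, hk, hkj, hki, h⟩
  · rintro ⟨hj, hi, k, hk, hkj, hki, h⟩
    exact ⟨hi, hj, k, hk, hki, hkj, h⟩

/-! ### Invariance under the reflection -/

/-- Four distinct elements do not fit into a set of three (plumbing for "the third direction is `0`"). -/
private theorem eq_of_card_three {D : Finset (Fin d)} (hD : D.card = 3) {a b c x : Fin d} (ha : a ∈ D) (hb : b ∈ D)
    (hc : c ∈ D) (hx : x ∈ D) (hab : a ≠ b) (hac : a ≠ c) (hbc : b ≠ c) (hxa : x ≠ a) (hxb : x ≠ b) : x = c := by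
  by_contra hxc
  have hsub : ({a, b, c, x} : Finset (Fin d)) ⊆ D := by
    intro y hy
    simp only [Finset.mem_insert, Finset.mem_singleton] at hy
    rcases hy with rfl | rfl | rfl | rfl <;> assumption
  have hcard : ({a, b, c, x} : Finset (Fin d)).card = 4 := by
    rw [Finset.card_insert_of_notMem (by simp [hab, hac, Ne.symm hxa]),
      Finset.card_insert_of_notMem (by simp [hbc, Ne.symm hxb]),
      Finset.card_insert_of_notMem (by simp [Ne.symm hxc]), Finset.card_singleton]
  have := Finset.card_le_card hsub
  omega

/-- **Every cube pattern is invariant under the Osterwalder–Seiler reflection of plaquettes** (`L` even, three directions,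
class set closed under the coordinates outside `D`): temporal faces keep the parity of their base; for spatial faces either
`0 ∉ D` (the time parity is irrelevant) or the third direction is `0` and the reflection exchanges "lower face of the cube
at `x`" with "upper face of the cube at `x - e₀`". -/
theorem isCubeFace_plaqReflect_iff [NeZero d] (hL : Even L) {D : Finset (Fin d)} {P : Finset (Fin d → ZMod 2)}
    (hD : D.card = 3) (hP : IsOutsideClosed D P) (p : Plaquette d L) :
    IsCubeFace D P (plaqReflect p) ↔ IsCubeFace D P p := by
  obtain ⟨x, ⟨⟨i, j⟩, hij⟩⟩ := p
  have hij' : i < j := hij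
  have hj0 : j ≠ 0 := fun h => by rw [h] at hij'; exact (Fin.not_lt_zero i) hij'
  unfold IsCubeFace plaqReflect
  by_cases hi : i = 0
  · subst hi
    simp only [↓reduceIte, sitePar_shift_timeReflect hL]
  · simp only [hi, ↓reduceIte, sitePar_timeReflect hL]
    refine and_congr_right fun hiD => and_congr_right fun hjD => exists_congr fun k => and_congr_right fun hkD =>
      and_congr_right fun hki => and_congr_right fun hkj => ?_
    by_cases h0 : (0 : Fin d) ∈ D
    · have hk0 : k = 0 := eq_of_card_three hD hiD hjD h0 hkD (ne_of_lt hij') hi hj0 hki hkj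
      subst hk0
      rw [par_add_add_cancel]
      exact Or.comm
    · rw [hP.mem_add_iff h0, add_right_comm, hP.mem_add_iff h0]

/-- The pattern as a set of plaquettes is reflection invariant. -/
theorem mem_cubePattern_plaqReflect_iff [NeZero d] [NeZero L] (hL : Even L) {D : Finset (Fin d)}
    {P : Finset (Fin d → ZMod 2)} (hD : D.card = 3) (hP : IsOutsideClosed D P) (p : Plaquette d L) :
    plaqReflect p ∈ cubePattern D P ↔ p ∈ cubePattern D P := by
  rw [mem_cubePattern, mem_cubePattern, isCubeFace_plaqReflect_iff hL hD hP]

/-! ### Translations -/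

/-- The translated class set: `w ∈ parShift u P ↔ w + u ∈ P`. -/
def parShift (u : Fin d → ZMod 2) (P : Finset (Fin d → ZMod 2)) : Finset (Fin d → ZMod 2) :=
  P.image fun w => w + u

/-- Membership in the translated class set. -/
theorem mem_parShift {u : Fin d → ZMod 2} {P : Finset (Fin d → ZMod 2)} {w : Fin d → ZMod 2} :
    w ∈ parShift u P ↔ w + u ∈ P := by
  unfold parShift
  rw [Finset.mem_image]
  constructor
  · rintro ⟨w', hw', rfl⟩
    rwa [par_add_add_cancel]
  · intro h
    exact ⟨w + u, h, par_add_add_cancel w u⟩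

/-- Translated class sets stay closed outside `D`. -/
theorem isOutsideClosed_parShift {D : Finset (Fin d)} {P : Finset (Fin d → ZMod 2)} (hP : IsOutsideClosed D P) (u : Fin d → ZMod 2) :
    IsOutsideClosed D (parShift u P) := by
  intro w hw m hm
  rw [mem_parShift] at hw ⊢
  rw [add_right_comm]
  exact hP _ hw m hm

/-- **Translations map patterns to patterns**: `p + v ∈ S(D, P) ↔ p ∈ S(D, parShift (sitePar v) P)`. -/
theorem isCubeFace_plaqShift_iff (hL : Even L) {D : Finset (Fin d)} {P : Finset (Fin d → ZMod 2)} (v : Site d L)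
    (p : Plaquette d L) : IsCubeFace D P (plaqShift v p) ↔ IsCubeFace D (parShift (sitePar v) P) p := by
  obtain ⟨x, q⟩ := p
  unfold IsCubeFace plaqShift
  simp only [sitePar_add hL, mem_parShift, add_right_comm _ (sitePar v)]

/-! ### Transpositions -/

/-- The transposed direction set: `k ∈ dirsImage μ ν D ↔ (μ ν) k ∈ D`. -/
def dirsImage (μ ν : Fin d) (D : Finset (Fin d)) : Finset (Fin d) := D.image (Equiv.swap μ ν)

/-- Membership in the transposed direction set. -/
theorem mem_dirsImage {μ ν : Fin d} {D : Finset (Fin d)} {k : Fin d} : k ∈ dirsImage μ ν D ↔ Equiv.swap μ ν k ∈ D := by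
  unfold dirsImage
  rw [Finset.mem_image]
  constructor
  · rintro ⟨k', hk', rfl⟩
    rwa [Equiv.swap_apply_self]
  · intro h
    exact ⟨_, h, Equiv.swap_apply_self _ _ _⟩

/-- Transposition preserves the number of directions. -/
theorem card_dirsImage (μ ν : Fin d) (D : Finset (Fin d)) : (dirsImage μ ν D).card = D.card :=
  Finset.card_image_of_injective _ (Equiv.swap μ ν).injective

/-- The transposed class set: `w ∈ parTranspose μ ν P ↔ w ∘ (μ ν) ∈ P`. -/
def parTranspose (μ ν : Fin d) (P : Finset (Fin d → ZMod 2)) : Finset (Fin d → ZMod 2) :=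
  P.image fun w => w ∘ Equiv.swap μ ν

/-- `(w ∘ τ) ∘ τ = w` for a transposition `τ` (plumbing). -/
private theorem comp_swap_comp_swap (μ ν : Fin d) (w : Fin d → ZMod 2) :
    (w ∘ Equiv.swap μ ν) ∘ Equiv.swap μ ν = w := by
  funext m
  simp only [Function.comp_apply, Equiv.swap_apply_self]

/-- Membership in the transposed class set. -/
theorem mem_parTranspose {μ ν : Fin d} {P : Finset (Fin d → ZMod 2)} {w : Fin d → ZMod 2} :
    w ∈ parTranspose μ ν P ↔ w ∘ Equiv.swap μ ν ∈ P := by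
  unfold parTranspose
  rw [Finset.mem_image]
  constructor
  · rintro ⟨w', hw', rfl⟩
    rwa [comp_swap_comp_swap]
  · intro h
    exact ⟨_, h, comp_swap_comp_swap μ ν w⟩

/-- Transposed class sets stay closed outside the transposed direction set. -/
theorem isOutsideClosed_parTranspose {D : Finset (Fin d)} {P : Finset (Fin d → ZMod 2)} (hP : IsOutsideClosed D P) (μ ν : Fin d) :
    IsOutsideClosed (dirsImage μ ν D) (parTranspose μ ν P) := by
  intro w hw m hm
  rw [mem_parTranspose] at hw ⊢
  rw [mem_dirsImage] at hm
  have h := hP _ hw _ hm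
  rwa [← single_comp_swap μ ν m] at h

/-- The two directions of the transposed plaquette are the transposed directions (in some order). -/
theorem dirTranspose_dirs (μ ν : Fin d) (q : {p : Fin d × Fin d // p.1 < p.2}) :
    ((dirTranspose μ ν q).1.1 = Equiv.swap μ ν q.1.1 ∧ (dirTranspose μ ν q).1.2 = Equiv.swap μ ν q.1.2) ∨
      ((dirTranspose μ ν q).1.1 = Equiv.swap μ ν q.1.2 ∧ (dirTranspose μ ν q).1.2 = Equiv.swap μ ν q.1.1) := by
  unfold dirTranspose
  split_ifs
  · exact Or.inl ⟨rfl, rfl⟩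
  · exact Or.inr ⟨rfl, rfl⟩

/-- The pattern condition transposed. -/
theorem isCubeFaceAt_swap_iff {D : Finset (Fin d)} {P : Finset (Fin d → ZMod 2)} (μ ν : Fin d) (w : Fin d → ZMod 2)
    (i j : Fin d) :
    IsCubeFaceAt D P (w ∘ Equiv.swap μ ν) (Equiv.swap μ ν i) (Equiv.swap μ ν j) ↔
      IsCubeFaceAt (dirsImage μ ν D) (parTranspose μ ν P) w i j := by
  unfold IsCubeFaceAt
  simp only [mem_dirsImage, mem_parTranspose]
  refine and_congr_right fun _ => and_congr_right fun _ => ?_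
  constructor
  · rintro ⟨k, hk, hki, hkj, h⟩
    refine ⟨Equiv.swap μ ν k, by rwa [Equiv.swap_apply_self], fun e => hki (by rw [← e, Equiv.swap_apply_self]),
      fun e => hkj (by rw [← e, Equiv.swap_apply_self]), ?_⟩
    rcases h with h | h
    · exact Or.inl h
    · right
      rw [Function.comp_def] at h ⊢
      have e : (fun m => ((w + Pi.single (Equiv.swap μ ν k) 1 : Fin d → ZMod 2)) (Equiv.swap μ ν m)) =
          (fun m => w (Equiv.swap μ ν m)) + Pi.single k 1 := by
        funext m
        simp only [Pi.add_apply, Pi.single_apply, Equiv.swap_apply_eq_iff, Equiv.swap_apply_self]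
      rw [e]
      exact h
  · rintro ⟨k, hk, hki, hkj, h⟩
    refine ⟨Equiv.swap μ ν k, hk, fun e => hki ((Equiv.swap μ ν).injective e),
      fun e => hkj ((Equiv.swap μ ν).injective e), ?_⟩
    rcases h with h | h
    · exact Or.inl h
    · right
      rw [Function.comp_def] at h ⊢
      have e : (fun m => ((w + Pi.single k 1 : Fin d → ZMod 2)) (Equiv.swap μ ν m)) =
          (fun m => w (Equiv.swap μ ν m)) + Pi.single (Equiv.swap μ ν k) 1 := by
        funext m
        simp only [Pi.add_apply, Pi.single_apply, Equiv.swap_apply_eq_iff]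
      rw [e] at h
      exact h

/-- **Transpositions map patterns to patterns**: `τ_{μν} p ∈ S(D, P) ↔ p ∈ S(τD, τP)`. -/
theorem isCubeFace_plaqTranspose_iff {D : Finset (Fin d)} {P : Finset (Fin d → ZMod 2)} (μ ν : Fin d)
    (p : Plaquette d L) :
    IsCubeFace D P (plaqTranspose μ ν p) ↔ IsCubeFace (dirsImage μ ν D) (parTranspose μ ν P) p := by
  rw [isCubeFace_iff_patCond, isCubeFace_iff_patCond]
  have hx : sitePar (plaqTranspose μ ν p).1 = sitePar p.1 ∘ Equiv.swap μ ν := sitePar_siteTranspose μ ν p.1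
  rw [hx]
  rcases dirTranspose_dirs μ ν p.2 with ⟨h1, h2⟩ | ⟨h1, h2⟩
  · rw [show (plaqTranspose μ ν p).2 = dirTranspose μ ν p.2 from rfl, h1, h2]
    exact isCubeFaceAt_swap_iff μ ν _ _ _
  · rw [show (plaqTranspose μ ν p).2 = dirTranspose μ ν p.2 from rfl, h1, h2, isCubeFaceAt_comm]
    exact isCubeFaceAt_swap_iff μ ν _ _ _

/-! ### Transport to the reflection hyperplane -/

/-- Every plaquette is carried onto a crossing plaquette by the transposition of its first direction with the time axis
followed by a translation (the transport used in `MarkedPlaquetteTransport.markedIntegral_nonneg`). -/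
theorem exists_isCrossPlaq_transport [NeZero d] (p₀ : Plaquette d L) :
    ∃ μ : Fin d, ∃ v : Site d L, IsCrossPlaq (plaqShift v (plaqTranspose 0 μ p₀)) := by
  obtain ⟨x, ⟨⟨i, j⟩, hij⟩⟩ := p₀
  set q : Plaquette d L := plaqTranspose 0 i (x, ⟨(i, j), hij⟩) with hq
  have hij' : i < j := hij
  have hj0 : j ≠ 0 := fun h => by rw [h] at hij'; exact (Fin.not_lt_zero i) hij'
  have hji : j ≠ i := ne_of_gt hij'
  have hq1 : q.2.1.1 = 0 := by
    have hswi : Equiv.swap (0 : Fin d) i i = 0 := Equiv.swap_apply_right _ _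
    have hswj : Equiv.swap (0 : Fin d) i j = j := Equiv.swap_apply_of_ne_of_ne hj0 hji
    have hlt : Equiv.swap (0 : Fin d) i i < Equiv.swap (0 : Fin d) i j := by
      rw [hswi, hswj]; exact lt_of_le_of_ne (Fin.zero_le _) (Ne.symm hj0)
    have hdt : dirTranspose (0 : Fin d) i ⟨(i, j), hij⟩ =
        ⟨(Equiv.swap (0 : Fin d) i i, Equiv.swap (0 : Fin d) i j), hlt⟩ := by
      unfold dirTranspose
      rw [dif_pos hlt]
    rw [hq, plaqTranspose, hdt]
    exact hswi
  refine ⟨i, -q.1, ?_, Or.inl ?_⟩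
  · simpa [plaqShift] using hq1
  · simp [plaqShift, hq]

/-- **Transport of a cube pattern to the reflection hyperplane.**  On the even torus, for a direction set `D` of three
directions and a class set closed outside `D`: every plaquette `p₀` admits a lattice symmetry `σ = (translation by v) ∘
(transposition 0 ↔ μ)` with `σ p₀` a crossing plaquette and such that the pulled-back membership `q ↦ [σ⁻¹ q ∈ S(D, P)]` is
invariant under the reflection of plaquettes. -/
theorem cubePattern_transport [NeZero d] [NeZero L] (hL : Even L) {D : Finset (Fin d)} {P : Finset (Fin d → ZMod 2)}
    (hD : D.card = 3) (hP : IsOutsideClosed D P) (p₀ : Plaquette d L) :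
    ∃ μ : Fin d, ∃ v : Site d L, IsCrossPlaq (plaqShift v (plaqTranspose 0 μ p₀)) ∧
      ∀ q : Plaquette d L, plaqTranspose 0 μ (plaqShift (-v) (plaqReflect q)) ∈ cubePattern D P ↔
        plaqTranspose 0 μ (plaqShift (-v) q) ∈ cubePattern D P := by
  obtain ⟨μ, v, hcross⟩ := exists_isCrossPlaq_transport (d := d) (L := L) p₀
  refine ⟨μ, v, hcross, fun q => ?_⟩
  have key : ∀ q' : Plaquette d L, plaqTranspose 0 μ (plaqShift (-v) q') ∈ cubePattern D P ↔
      IsCubeFace (dirsImage 0 μ D) (parShift (sitePar (-v)) (parTranspose 0 μ P)) q' := fun q' => by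
    rw [mem_cubePattern, isCubeFace_plaqTranspose_iff, isCubeFace_plaqShift_iff hL]
  rw [key, key]
  exact isCubeFace_plaqReflect_iff hL (by rw [card_dirsImage, hD])
    (isOutsideClosed_parShift (isOutsideClosed_parTranspose hP 0 μ) _) q

end Summit.Ventures.YMGap.Census

end
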